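import Mathlib
import HarnessLib
import Summits.NavierStokesRegularity.NavierStokesRegularity.Theses.LoopPeriodRatchet

/-!
# Route `LoopPeriodRatchet`, support `NoLoopsOfRatchet` (stmt-NavierStokesRegularity-22495) — proved

Bookkeeping item of the D-0145 line `LoopPeriodRatchet` (ideator ns-idea-1; bears on the DOOR rung
N0-LocalTubeDoorPoloidal = `PoloidalWindowDoor.Target`, not the summit and not a Clay option).
Statement: `PeriodRatchet → PeriodScalingBound →` every e₃-poloidal Type-I Oseen-mild ancient profile has no
closed vortex line at any time `s < 0`, i.e. every periodic orbit `γ` (period `ℓ > 0`) of the frozen-slice ODE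
`y′ = curl v(s)(y)` is stationary, `curl v(s)(γ 0) = 0`.

Proof (pure real analysis, as announced in the item): if `curl v(s)(γ 0) ≠ 0`, the ratchet at tolerance
`δ = ℓ⁻¹/2` produces, for every earlier time `s₁ < s`, a non-stationary periodic orbit at time `s₁` with
inverse period `ℓ₁⁻¹ ≥ ℓ⁻¹ − ℓ⁻¹/2`, while the scaling bound gives `ℓ₁⁻¹ ≤ M(−s₁)^{−3/2}`; since
`M x^{−3/2} → 0` as `x → ∞` (`tendsto_rpow_neg_atTop`), taking `−s₁` large contradicts `ℓ⁻¹/2 > 0`.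
A candidate proof with the same mechanism was attached to the item by refuter-parity-tllh-ref-1-g3-0
(Proof22495.lean); this file is the prover's landing of it.
-/

noncomputable section

-- the summit and its single sub-problem share the name (CONVENTIONS §1), as in every Theorems file
set_option linter.dupNamespace false

namespace Summit.NavierStokesRegularity.NavierStokesRegularity.Theorems.LoopPeriodRatchetNoLoopsOfRatchet

open Filter Topology
open Summit.NavierStokesRegularity.NavierStokesRegularity.Theses.LoopPeriodRatchet

/-- **`NoLoopsOfRatchet` (stmt-NavierStokesRegularity-22495).** The period ratchet and the period scaling bound
together exclude closed vortex lines of e₃-poloidal Type-I Oseen-mild ancient profiles: every periodic orbit of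
`y′ = curl v(s)(y)` with a positive period is stationary. -/
theorem noLoopsOfRatchet_proof : NoLoopsOfRatchet := by
  unfold NoLoopsOfRatchet
  intro hR hB C v hrate hcont hmild hdiv hpol s hs γ ℓ hℓ hγ hper
  by_contra hne
  obtain ⟨M, hM⟩ := hB C
  have hℓi : 0 < ℓ⁻¹ := inv_pos.2 hℓ
  -- the ratchet at tolerance `ℓ⁻¹/2` combined with the scaling bound at every earlier time
  have key : ∀ s₁ < s, ℓ⁻¹ ≤ M * (-s₁) ^ (-(3 : ℝ) / 2) + ℓ⁻¹ / 2 := by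
    intro s₁ hs₁
    obtain ⟨γ₁, ℓ₁, hℓ₁, hγ₁, hper₁, hne₁, hle⟩ :=
      hR C v hrate hcont hmild hdiv hpol s₁ s hs₁ hs γ ℓ hℓ hγ hper hne (ℓ⁻¹ / 2) (half_pos hℓi)
    have hb := hM v hrate hcont hmild hdiv s₁ (hs₁.trans hs) γ₁ ℓ₁ hℓ₁ hγ₁ hper₁ hne₁
    linarith
  -- `M x^{-3/2} → 0` as `x → ∞`
  have hexp : (-(3 : ℝ) / 2) = -((3 : ℝ) / 2) := by ring
  have hlim : Tendsto (fun x : ℝ => M * x ^ (-(3 : ℝ) / 2)) atTop (𝓝 0) := by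
    have h := (tendsto_rpow_neg_atTop (y := (3 : ℝ) / 2) (by norm_num)).const_mul M
    rw [mul_zero] at h
    simpa only [hexp] using h
  have hev : ∀ᶠ x : ℝ in atTop, M * x ^ (-(3 : ℝ) / 2) < ℓ⁻¹ / 2 :=
    (tendsto_order.1 hlim).2 _ (half_pos hℓi)
  obtain ⟨x, hx, hxs⟩ := (hev.and (eventually_gt_atTop (-s))).exists
  have h := key (-x) (by linarith)
  rw [neg_neg] at h
  linarith

end Summit.NavierStokesRegularity.NavierStokesRegularity.Theorems.LoopPeriodRatchetNoLoopsOfRatchet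

end
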